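import Mathlib

/-!
# Solo-blind: the Newton closing step with polynomial loss (steady door, R4c)

In the steady thin-box programme (paper §24.17(8″)) the reduced pattern state is upgraded to an
exact steady Navier–Stokes state by one application of the contraction principle to

  `F(u_app + v) = f₀ + A v + N v = 0`,

where `f₀ = F(u_app)` is the residual of an order-`N` approximate solution (`‖f₀‖ ≤ C₂ n^{-N}`),
`A = DF(u_app)` has a bounded right inverse with POLYNOMIAL LOSS in the thin-box parameter
(`‖A⁻¹‖ ≤ C₁ n^{β}`, the linear estimate (S1)), and the quadratic remainder `N` is locally
Lipschitz with constant `L (‖v‖ + ‖w‖)`, `L ≤ C₃ n^{γ}`.  Because the loss is a power of the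
PARAMETER `n` and not a loss of derivatives (`A⁻¹ : L² → H²`, `N : H² → L²`), no Nash–Moser scheme
is needed: the plain Banach fixed-point theorem closes as soon as `N > 2β + γ`.

* `newton_quadratic_close` — the abstract statement: `‖A⁻¹‖ ≤ M`, `‖f₀‖ ≤ r`, `N 0 = 0`,
  `‖N v − N w‖ ≤ L (‖v‖+‖w‖) ‖v − w‖` on the ball of radius `2 M r`, and `8 M² L r ≤ 1` give a
  solution `v` with `‖v‖ ≤ 2 M r`.  Only `A ∘ A⁻¹ = id` is used (a right inverse; `A` itself need
  not be linear).
* `newton_polynomial_loss` — the bookkeeping with `M = C₁ n^β`, `r = C₂ n^{-N}`, `L = C₃ n^γ`,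
  `N > 2β + γ`: for all real `n ≥ n₀` a solution exists with `‖v‖ ≤ 2 C₁ C₂ n^{β−N}`.
-/

namespace Summit.AnomalousDissipation.AnomalousDissipation.Theorems

open Metric Set Filter Topology

variable {E F : Type*} [NormedAddCommGroup E] [NormedSpace ℝ E] [CompleteSpace E]
  [NormedAddCommGroup F] [NormedSpace ℝ F]

/-- Newton closing step (contraction form).  `A` has the bounded linear right inverse `Ainv`
with `‖Ainv‖ ≤ M`; the residual satisfies `‖f₀‖ ≤ r`; the remainder `N` vanishes at `0` and is
Lipschitz with constant `L (‖v‖ + ‖w‖)` on the closed ball of radius `2 M r`; and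
`8 M² L r ≤ 1`.  Then `f₀ + A v + N v = 0` has a solution with `‖v‖ ≤ 2 M r`. -/
theorem newton_quadratic_close (f₀ : F) (A : E → F) (Ainv : F →L[ℝ] E) (N : E → F)
    (hA : ∀ y, A (Ainv y) = y) {M r L : ℝ} (hM0 : 0 ≤ M) (hr0 : 0 ≤ r) (hL0 : 0 ≤ L)
    (hM : ‖Ainv‖ ≤ M) (hr : ‖f₀‖ ≤ r) (hN0 : N 0 = 0)
    (hN : ∀ v w : E, ‖v‖ ≤ 2 * M * r → ‖w‖ ≤ 2 * M * r →
      ‖N v - N w‖ ≤ L * (‖v‖ + ‖w‖) * ‖v - w‖)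
    (hsmall : 8 * M ^ 2 * L * r ≤ 1) :
    ∃ v : E, ‖v‖ ≤ 2 * M * r ∧ f₀ + A v + N v = 0 := by
  have hρ0 : 0 ≤ 2 * M * r := by positivity
  set T : E → E := fun v => Ainv (-(f₀ + N v)) with hT
  set s : Set E := closedBall (0 : E) (2 * M * r) with hs
  -- size of the remainder on the ball
  have hNv : ∀ v : E, ‖v‖ ≤ 2 * M * r → ‖N v‖ ≤ L * (2 * M * r) * (2 * M * r) := by
    intro v hv
    have h := hN v 0 hv (by simpa using hρ0)
    rw [hN0, sub_zero, norm_zero, add_zero, sub_zero] at h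
    have h1 : L * ‖v‖ ≤ L * (2 * M * r) := mul_le_mul_of_nonneg_left hv hL0
    exact h.trans (mul_le_mul h1 hv (norm_nonneg _) (by positivity))
  have hLρ : L * (2 * M * r) * (2 * M * r) ≤ r / 2 := by
    have : L * (2 * M * r) * (2 * M * r) = (8 * M ^ 2 * L * r) * r / 2 := by ring
    rw [this]
    nlinarith
  -- the Newton map sends the ball into itself
  have hmaps : MapsTo T s s := by
    intro v hv
    rw [hs, mem_closedBall, dist_zero_right] at hv ⊢
    calc ‖T v‖ = ‖Ainv (-(f₀ + N v))‖ := rfl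
      _ ≤ ‖Ainv‖ * ‖-(f₀ + N v)‖ := Ainv.le_opNorm _
      _ ≤ M * (r + L * (2 * M * r) * (2 * M * r)) := by
          rw [norm_neg]
          exact mul_le_mul hM ((norm_add_le _ _).trans (add_le_add hr (hNv v hv)))
            (norm_nonneg _) hM0
      _ ≤ 2 * M * r := by
          nlinarith [mul_le_mul_of_nonneg_left hLρ hM0]
  -- and is a contraction there with constant 1/2
  set K : NNReal := ⟨1 / 2, by norm_num⟩ with hK
  have hlip : LipschitzOnWith K T s := by
    refine LipschitzOnWith.of_dist_le_mul fun v hv w hw => ?_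
    rw [hs, mem_closedBall, dist_zero_right] at hv hw
    rw [dist_eq_norm, dist_eq_norm]
    change ‖T v - T w‖ ≤ (1 / 2 : ℝ) * ‖v - w‖
    have hvw : ‖v‖ + ‖w‖ ≤ 4 * M * r := by linarith
    have h2 : L * (‖v‖ + ‖w‖) ≤ L * (4 * M * r) := mul_le_mul_of_nonneg_left hvw hL0
    have h3 : M * (L * (‖v‖ + ‖w‖)) ≤ M * (L * (4 * M * r)) := mul_le_mul_of_nonneg_left h2 hM0
    have h4 : M * (L * (4 * M * r)) = (8 * M ^ 2 * L * r) / 2 := by ring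
    have h5 : M * (L * (‖v‖ + ‖w‖)) ≤ 1 / 2 := by linarith
    calc ‖T v - T w‖ = ‖Ainv (-(f₀ + N v) - -(f₀ + N w))‖ := by
            simp only [hT, map_sub]
      _ ≤ ‖Ainv‖ * ‖-(f₀ + N v) - -(f₀ + N w)‖ := Ainv.le_opNorm _
      _ = ‖Ainv‖ * ‖N v - N w‖ := by
            rw [show -(f₀ + N v) - -(f₀ + N w) = -(N v - N w) by abel, norm_neg]
      _ ≤ M * (L * (‖v‖ + ‖w‖) * ‖v - w‖) := mul_le_mul hM (hN v w hv hw) (norm_nonneg _) hM0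
      _ = (M * (L * (‖v‖ + ‖w‖))) * ‖v - w‖ := by ring
      _ ≤ (1 / 2 : ℝ) * ‖v - w‖ := mul_le_mul_of_nonneg_right h5 (norm_nonneg _)
  have hK1 : K < 1 := by
    change (1 / 2 : ℝ) < 1
    norm_num
  have hcontr : ContractingWith K (hmaps.restrict T s s) :=
    ⟨hK1, (hmaps.lipschitzOnWith_iff_restrict).mp hlip⟩
  have hcomplete : IsComplete s := isClosed_closedBall.isComplete
  obtain ⟨v, hvs, hfix, -⟩ :=
    hcontr.exists_fixedPoint' hcomplete hmaps (mem_closedBall_self hρ0) (edist_ne_top _ _)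
  refine ⟨v, ?_, ?_⟩
  · rw [hs, mem_closedBall, dist_zero_right] at hvs
    exact hvs
  · have h1 : T v = v := hfix
    have hAv : A v = -(f₀ + N v) := by
      calc A v = A (T v) := by rw [h1]
        _ = -(f₀ + N v) := hA _
    rw [hAv]
    abel

/-- Newton closing step with POLYNOMIAL LOSS in a parameter `n` (paper §24.17(8″)): right-inverse
bound `C₁ n^β`, residual `C₂ n^{-N}`, remainder constant `C₃ n^γ`, and `N > 2β + γ`.  Then for all
real `n ≥ n₀` the equation `f₀ + A v + Nl v = 0` has a solution with `‖v‖ ≤ 2 C₁ C₂ n^{β−N}` —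
the loss `β` only raises the order `N` to which the approximate solution must be built. -/
theorem newton_polynomial_loss {β γ Nn C₁ C₂ C₃ : ℝ} (hC₁ : 0 ≤ C₁) (hC₂ : 0 ≤ C₂) (hC₃ : 0 ≤ C₃)
    (hgap : 2 * β + γ < Nn) :
    ∃ n₀ : ℝ, 0 < n₀ ∧ ∀ n : ℝ, n₀ ≤ n →
      ∀ (f₀ : F) (A : E → F) (Ainv : F →L[ℝ] E) (Nl : E → F),
        (∀ y, A (Ainv y) = y) → ‖Ainv‖ ≤ C₁ * n ^ β → ‖f₀‖ ≤ C₂ * n ^ (-Nn) → Nl 0 = 0 →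
        (∀ v w : E, ‖v‖ ≤ 2 * (C₁ * n ^ β) * (C₂ * n ^ (-Nn)) →
            ‖w‖ ≤ 2 * (C₁ * n ^ β) * (C₂ * n ^ (-Nn)) →
            ‖Nl v - Nl w‖ ≤ C₃ * n ^ γ * (‖v‖ + ‖w‖) * ‖v - w‖) →
        ∃ v : E, ‖v‖ ≤ 2 * C₁ * C₂ * n ^ (β - Nn) ∧ f₀ + A v + Nl v = 0 := by
  -- choose n₀ with 8 C₁² C₂ C₃ n^{-(N - 2β - γ)} ≤ 1 for n ≥ n₀
  have hδ : 0 < Nn - 2 * β - γ := by linarith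
  set c : ℝ := 8 * C₁ ^ 2 * C₂ * C₃ with hc
  have hc0 : 0 ≤ c := by positivity
  have hev : ∀ᶠ x : ℝ in atTop, x ^ (-(Nn - 2 * β - γ)) ≤ 1 / (c + 1) :=
    (tendsto_rpow_neg_atTop hδ).eventually (eventually_le_nhds (by positivity))
  obtain ⟨a, ha⟩ := eventually_atTop.mp hev
  refine ⟨max a 1, lt_max_of_lt_right one_pos, fun n hn f₀ A Ainv Nl hA hM hr hN0 hN => ?_⟩
  have hn1 : 1 ≤ n := (le_max_right a 1).trans hn
  have hnpos : 0 < n := one_pos.trans_le hn1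
  have hsmallx : n ^ (-(Nn - 2 * β - γ)) ≤ 1 / (c + 1) := ha n ((le_max_left a 1).trans hn)
  -- the data of `newton_quadratic_close`
  have hM0 : 0 ≤ C₁ * n ^ β := mul_nonneg hC₁ (Real.rpow_nonneg hnpos.le _)
  have hr0 : 0 ≤ C₂ * n ^ (-Nn) := mul_nonneg hC₂ (Real.rpow_nonneg hnpos.le _)
  have hL0 : 0 ≤ C₃ * n ^ γ := mul_nonneg hC₃ (Real.rpow_nonneg hnpos.le _)
  have hpow : (n ^ β) ^ 2 * n ^ γ * n ^ (-Nn) = n ^ (-(Nn - 2 * β - γ)) := by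
    rw [← Real.rpow_natCast, ← Real.rpow_mul hnpos.le, ← Real.rpow_add hnpos,
      ← Real.rpow_add hnpos]
    congr 1
    push_cast
    ring
  have hsmall : 8 * (C₁ * n ^ β) ^ 2 * (C₃ * n ^ γ) * (C₂ * n ^ (-Nn)) ≤ 1 := by
    have h1 : 8 * (C₁ * n ^ β) ^ 2 * (C₃ * n ^ γ) * (C₂ * n ^ (-Nn))
        = c * ((n ^ β) ^ 2 * n ^ γ * n ^ (-Nn)) := by rw [hc]; ring
    rw [h1, hpow]
    have h2 : c * n ^ (-(Nn - 2 * β - γ)) ≤ c * (1 / (c + 1)) :=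
      mul_le_mul_of_nonneg_left hsmallx hc0
    have h3 : c * (1 / (c + 1)) ≤ 1 := by
      rw [mul_one_div, div_le_one (by positivity)]
      linarith
    exact h2.trans h3
  have hN' : ∀ v w : E, ‖v‖ ≤ 2 * (C₁ * n ^ β) * (C₂ * n ^ (-Nn)) →
      ‖w‖ ≤ 2 * (C₁ * n ^ β) * (C₂ * n ^ (-Nn)) →
      ‖Nl v - Nl w‖ ≤ C₃ * n ^ γ * (‖v‖ + ‖w‖) * ‖v - w‖ := hN
  obtain ⟨v, hv, hsol⟩ :=
    newton_quadratic_close f₀ A Ainv Nl hA hM0 hr0 hL0 hM hr hN0 hN' hsmall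
  refine ⟨v, ?_, hsol⟩
  have h2 : 2 * (C₁ * n ^ β) * (C₂ * n ^ (-Nn)) = 2 * C₁ * C₂ * n ^ (β - Nn) := by
    rw [sub_eq_add_neg, Real.rpow_add hnpos]
    ring
  rw [← h2]
  exact hv

end Summit.AnomalousDissipation.AnomalousDissipation.Theorems
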